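import Summits.Ventures.PackingBounds.Configurations.GroundStateSeries
import Summits.Ventures.PackingBounds.Configurations.SixHundredCellUnique
import Summits.Ventures.PackingBounds.Energy.UniversalOptimalitySixHundredCell

/-!
# Uniqueness of the 600-cell ground state for absolutely monotone and Riesz potentials

Framing: lottery ticket; floor = certified bounds/negative ranges. Venture `PackingBounds` (cell
`pub-packcert`, seat `pub-packcert-energy`) — Cohn–Kumar Table 1, the 600-cell row: the uniqueness clause of
Cohn–Kumar's Theorem 1.2 in full strength.

`SixHundredCellUnique` proves uniqueness of the `120`-point ground state of `(1+t)^k` (`k ≥ 18`). With the tree's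
universal `(1+t)^k` bounds (`Energy.UniversalSixHundredCell.ckPow_energy_ge`) and `GroundStateSeries`: **if `a` is
absolutely monotone on `[-1,1)` with `a^(k)(-1) > 0` for some `k ≥ 18` (e.g. `a` strictly absolutely monotone),
every `120`-point configuration on `S³` with the minimal `a`-energy is an isometric image of the 600-cell
`Config.SixHundredCell.pts`** (`isometric_pts_of_energy_eq_of_absolutelyMonotoneOn`); in particular **the 600-cell is
the unique minimiser of every Riesz energy `Σ |x - y|^(-2p)`, `p > 0`, among `120` points on `S³`**
(`riesz_ground_state_unique`).

## References
* H. Cohn, A. Kumar, J. Amer. Math. Soc. 20 (2007) 99–148, Theorem 1.2 and Table 1. [`CohnKumar2006`]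
* P. Boyvalenkov, D. Danev, Arch. Math. 77 (2001) 360–368.
-/

noncomputable section

namespace Summit.Ventures.PackingBounds.Config.SixHundredCellGroundState

open Finset Set

/-- The eight inner products of the 600-cell (in the order of `Config.SixHundredCell.energy_pts`). -/
private def tv : Fin 8 → ℝ :=
  ![-1, (-1 / 4 : ℝ) + (-1 / 4 : ℝ) * Real.sqrt 5, -1 / 2, (1 / 4 : ℝ) + (-1 / 4 : ℝ) * Real.sqrt 5, 0,
    (-1 / 4 : ℝ) + (1 / 4 : ℝ) * Real.sqrt 5, 1 / 2, (1 / 4 : ℝ) + (1 / 4 : ℝ) * Real.sqrt 5]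

/-- Their multiplicities around a vertex. -/
private def mv : Fin 8 → ℝ := ![1, 12, 20, 12, 30, 12, 20, 12]

section config

variable {C : Finset (EuclideanSpace ℝ (Fin 4))} (h1 : ∀ x ∈ C, ‖x‖ = 1) (hN : C.card = 120)
include h1 hN

/-- The universal `(1+t)^k` bound in the indexed form of `GroundStateSeries`. -/
private theorem bound (k : ℕ) :
    (120 : ℝ) * ∑ i : Fin 8, mv i * (1 + tv i) ^ k ≤ ∑ x ∈ C, ∑ y ∈ C.erase x, (1 + inner ℝ x y) ^ k := by
  have h := Energy.UniversalSixHundredCell.ckPow_energy_ge k C h1 hN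
  simp only [Fin.sum_univ_succ, Fin.sum_univ_zero, mv, tv, Matrix.cons_val_zero, Matrix.cons_val_succ] at h ⊢
  convert h using 1
  ring

omit h1 hN in
/-- The node values lie in `[-1, 1)`. -/
private theorem nodes_mem : ∀ i : Fin 8, -1 ≤ tv i ∧ tv i < 1 := by
  obtain ⟨_, hlo, hhi⟩ := SixHundredCellCode.sqrt5_facts
  intro i
  fin_cases i <;> simp [tv] <;> (try constructor) <;> nlinarith [hlo, hhi]

/-- **Unique ground state for absolutely monotone potentials** (`k ≥ 18`, `a^(k)(-1) > 0`): the minimiser is an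
isometric image of the 600-cell. [cite: CohnKumar2006, Theorem 1.2] -/
theorem isometric_pts_of_energy_eq_of_absolutelyMonotoneOn (a : ℝ → ℝ) (ha : AbsolutelyMonotoneOn a (Ico (-1) 1))
    (k : ℕ) (hk : 18 ≤ k) (hpos : 0 < iteratedDerivWithin k a (Ico (-1) 1) (-1))
    (hE : ∑ x ∈ C, ∑ y ∈ C.erase x, a (inner ℝ x y) =
      (120 : ℝ) * (a (-1 : ℝ) + 12 * a ((-1 / 4 : ℝ) + (-1 / 4 : ℝ) * Real.sqrt 5)
        + 20 * a (-1 / 2 : ℝ) + 12 * a ((1 / 4 : ℝ) + (-1 / 4 : ℝ) * Real.sqrt 5) + 30 * a (0 : ℝ)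
        + 12 * a ((-1 / 4 : ℝ) + (1 / 4 : ℝ) * Real.sqrt 5) + 20 * a (1 / 2 : ℝ)
        + 12 * a ((1 / 4 : ℝ) + (1 / 4 : ℝ) * Real.sqrt 5))) :
    ∃ Ψ : EuclideanSpace ℝ (Fin 4) ≃ₗᵢ[ℝ] EuclideanSpace ℝ (Fin 4), C = SixHundredCell.pts.image Ψ := by
  have h := GroundStateSeries.ckPow_energy_eq_of_absolutelyMonotoneOn h1 120 tv mv nodes_mem (bound h1 hN) a ha
    hpos (by rw [hE]; simp [Fin.sum_univ_succ, tv, mv]; ring)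
  refine SixHundredCellCode.isometric_pts_of_ckPow_energy_eq h1 hN k hk ?_
  rw [h]; simp [Fin.sum_univ_succ, tv, mv]; ring

/-- **The 600-cell is the unique minimiser of every Riesz energy among `120` points on `S³`** (`p > 0`; energy
`Σ_(x ≠ y) (2 - 2⟪x,y⟫)^(-p) = Σ |x-y|^(-2p)`; the minimum is `Energy.RieszAbsolutelyMonotone.riesz_energy_ge_SixHundredCell`).
[cite: CohnKumar2006, Theorem 1.2] -/
theorem riesz_ground_state_unique (p : ℝ) (hp : 0 < p)
    (hE : ∑ x ∈ C, ∑ y ∈ C.erase x, (2 - 2 * inner ℝ x y) ^ (-p) =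
      (120 : ℝ) * ((4 : ℝ) ^ (-p) + 12 * (2 - 2 * ((-1 / 4 : ℝ) + (-1 / 4 : ℝ) * Real.sqrt 5)) ^ (-p)
        + 20 * (3 : ℝ) ^ (-p) + 12 * (2 - 2 * ((1 / 4 : ℝ) + (-1 / 4 : ℝ) * Real.sqrt 5)) ^ (-p)
        + 30 * (2 : ℝ) ^ (-p) + 12 * (2 - 2 * ((-1 / 4 : ℝ) + (1 / 4 : ℝ) * Real.sqrt 5)) ^ (-p)
        + 20 * (1 : ℝ) ^ (-p) + 12 * (2 - 2 * ((1 / 4 : ℝ) + (1 / 4 : ℝ) * Real.sqrt 5)) ^ (-p))) :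
    ∃ Ψ : EuclideanSpace ℝ (Fin 4) ≃ₗᵢ[ℝ] EuclideanSpace ℝ (Fin 4), C = SixHundredCell.pts.image Ψ := by
  refine isometric_pts_of_energy_eq_of_absolutelyMonotoneOn h1 hN (fun t : ℝ => (2 - 2 * t) ^ (-p))
    (Energy.RieszAbsolutelyMonotone.absolutelyMonotoneOn_rpow_chordal p hp.le) 18 le_rfl
    (E8GroundState.iteratedDerivWithin_rpow_chordal_pos p hp 18) ?_
  rw [hE]
  norm_num

end config

end Summit.Ventures.PackingBounds.Config.SixHundredCellGroundState

end
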